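import Summits.Ventures.Crystal3D.Theorems.StickyWulffConstantGenericWallFloorBarlowOrientedGlue
import HarnessLib

/-!
# F4 glue for up-presented plates with the DOUBLED margin term `36·m·ρ` (lane T's v3 `hlines`, zig|zig corner of the row split)
# (crux `GenericWallFloor`, stmt-Ventures-19480, line `WallLedgerG`; `bilayerWallRowCovFrom_of_lineCounts`)

HONEST FRAMING. Venture `Summits/Ventures/Crystal3D` (cell `crystal3d-full`), helper `--supports` the crux `GenericWallFloor`
(stmt-Ventures-19480) of `route-Ventures-StickyWulffConstant`, registered line `WallLedgerG`, open stub `stub_twoSlabAdhesion`.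
Rung credit only; F-C1 not moved; NOT the stub.  VERBATIM `barlow_hlines_oriented` (`…BarlowOrientedGlue`, 19480-p2 g7) with the
margin term `18·m·ρ` replaced by lane T's v3 `36·m·ρ` and the constant `318 + 192R₀` by `540 + 384R₀` (`36·(15 + 8h/3 + 32R₀/3) ≤
(540 + 384R₀)(1+h)`): the zig|zig corner of `barlow_rowhlines` needs the same margin bookkeeping as the row corners
(`…BarlowRowOrientedGlue`).  Inputs BY NAME: E1, `DoubleStarCoaxialAt` / `CapPairCoaxial`, off-registry clauses, up-presentations.
* **`barlow_hlines_oriented36`**.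
WHAT THIS IS NOT: not the stub; F-C1 not moved.
-/

noncomputable section

namespace Summit.Ventures.Crystal3D.Theorems

open Finset
open Literature.MathematicalPhysics.StatisticalMechanics
open Summit.Ventures.Crystal3D.Cruxes.TextureLiminf.TexShadow (stacking cyl upSlot₁ upSlot₂ upSlot₃ bilayerRise)
open scoped InnerProductSpace

/-- **F4 glue for up-presented plates, margin term `36·m·ρ`.**  See the module docstring. -/
theorem barlow_hlines_oriented36
    {sE : EuclideanSpace ℝ (Fin 3)} (hsE : sE ∈ fccSlots) (hcert : ExactOnly 0 (fccSlots.filter fun w => 0 < ⟪w, sE⟫_ℝ))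
    (hDS : ∀ F₁ F₂ : EuclideanSpace ℝ (Fin 3) ≃ₗᵢ[ℝ] EuclideanSpace ℝ (Fin 3), DoubleStarCoaxialAt F₁ F₂) (hCP : CapPairCoaxial)
    {σ₁ σ₂ : ℤ → ℤ} (hσ₁ : IsHaggSeq σ₁) (hσ₂ : IsHaggSeq σ₂)
    (L₁ L₂ : EuclideanSpace ℝ (Fin 3) ≃ₗᵢ[ℝ] EuclideanSpace ℝ (Fin 3)) (s₁ s₂ : EuclideanSpace ℝ (Fin 3))
    (hax₁ : 0 ≤ (L₁.symm (EuclideanSpace.single (2 : Fin 3) (1 : ℝ))) 2)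
    (hax₂ : 0 ≤ (L₂.symm (-EuclideanSpace.single (2 : Fin 3) (1 : ℝ))) 2)
    (hsteep₁ : Real.sqrt 2 / 2 ≤ ⟪L₁ (best3 (fun w => ⟪w, L₁.symm (EuclideanSpace.single (2 : Fin 3) (1 : ℝ))⟫_ℝ) upSlot₁ upSlot₂ upSlot₃),
      EuclideanSpace.single (2 : Fin 3) (1 : ℝ)⟫_ℝ)
    (hsteep₂ : Real.sqrt 2 / 2 ≤ ⟪L₂ (best3 (fun w => ⟪w, L₂.symm (-EuclideanSpace.single (2 : Fin 3) (1 : ℝ))⟫_ℝ) upSlot₁ upSlot₂ upSlot₃),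
      -EuclideanSpace.single (2 : Fin 3) (1 : ℝ)⟫_ℝ)
    (hoff₁ : ∀ y ∈ reachSet L₁ (L₁ ((haggLabel σ₁ 0 : ℝ) • barlowOffset 1) + s₁)
      (chainFrames (EuclideanSpace.single (2 : Fin 3) (1 : ℝ)) L₁
        (best3 (fun w => ⟪w, L₁.symm (EuclideanSpace.single (2 : Fin 3) (1 : ℝ))⟫_ℝ) upSlot₁ upSlot₂ upSlot₃)),
      y ∉ stacking L₂ s₂ σ₂)
    (hoff₂ : ∀ y ∈ reachSet L₂ (L₂ ((haggLabel σ₂ 0 : ℝ) • barlowOffset 1) + s₂)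
      (chainFrames (-EuclideanSpace.single (2 : Fin 3) (1 : ℝ)) L₂
        (best3 (fun w => ⟪w, L₂.symm (-EuclideanSpace.single (2 : Fin 3) (1 : ℝ))⟫_ℝ) upSlot₁ upSlot₂ upSlot₃)),
      y ∉ stacking L₁ s₁ σ₁)
    (hdisjR : ∀ y ∈ reachSet L₁ (L₁ ((haggLabel σ₁ 0 : ℝ) • barlowOffset 1) + s₁)
      (chainFrames (EuclideanSpace.single (2 : Fin 3) (1 : ℝ)) L₁
        (best3 (fun w => ⟪w, L₁.symm (EuclideanSpace.single (2 : Fin 3) (1 : ℝ))⟫_ℝ) upSlot₁ upSlot₂ upSlot₃)),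
      y ∉ reachSet L₂ (L₂ ((haggLabel σ₂ 0 : ℝ) • barlowOffset 1) + s₂)
        (chainFrames (-EuclideanSpace.single (2 : Fin 3) (1 : ℝ)) L₂
          (best3 (fun w => ⟪w, L₂.symm (-EuclideanSpace.single (2 : Fin 3) (1 : ℝ))⟫_ℝ) upSlot₁ upSlot₂ upSlot₃)))
    (R₀ : ℝ) (hR₀ : 6 ≤ R₀) :
    ∃ step₁ step₂ : ℤ → EuclideanSpace ℝ (Fin 3),
      IsZigSelector L₁ σ₁ (EuclideanSpace.single (2 : Fin 3) (1 : ℝ)) step₁ ∧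
      IsZigSelector L₂ σ₂ (-EuclideanSpace.single (2 : Fin 3) (1 : ℝ)) step₂ ∧
      ∀ h : ℝ, 0 ≤ h → ∀ ρ : ℝ, R₀ ≤ ρ → ∀ X P₁ P₂ : Finset (EuclideanSpace ℝ (Fin 3)),
      (∀ p ∈ X, ∀ q ∈ X, p ≠ q → 1 ≤ dist p q) → P₁ ⊆ X → P₂ ⊆ X \ P₁ → (∀ p ∈ X, p ∈ cyl R₀ h ρ) →
      (∀ p, p ∈ P₁ ↔ (p ∈ stacking L₁ s₁ σ₁ ∧ -(2 * R₀) ≤ p 2 ∧ p 2 ≤ -R₀ ∧ p 0 ^ 2 + p 1 ^ 2 ≤ ρ ^ 2)) →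
      (∀ p, p ∈ P₂ ↔ (p ∈ stacking L₂ s₂ σ₂ ∧ h + R₀ ≤ p 2 ∧ p 2 ≤ h + 2 * R₀ ∧ p 0 ^ 2 + p 1 ^ 2 ≤ ρ ^ 2)) →
      ∃ (m : ℝ) (T₁ T₂ : Finset (Fin 2 → ℤ)), 0 ≤ m ∧
        (∀ t : Fin 2 → ℤ, (∃ k : ℤ,
          -R₀ - 4 ≤ (L₁ (zigVertexS step₁ k + ((t 0 : ℝ) • triangularVec₁ 1 + (t 1 : ℝ) • triangularVec₂ 1)) + s₁) 2 ∧
          (L₁ (zigVertexS step₁ k + ((t 0 : ℝ) • triangularVec₁ 1 + (t 1 : ℝ) • triangularVec₂ 1)) + s₁) 2 ≤ -R₀ - 3 ∧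
          Real.sqrt ((L₁ (zigVertexS step₁ k + ((t 0 : ℝ) • triangularVec₁ 1 + (t 1 : ℝ) • triangularVec₂ 1)) + s₁) 0 ^ 2 +
            (L₁ (zigVertexS step₁ k + ((t 0 : ℝ) • triangularVec₁ 1 + (t 1 : ℝ) • triangularVec₂ 1)) + s₁) 1 ^ 2) ≤ ρ - m) →
          t ∈ T₁) ∧
        (∀ t : Fin 2 → ℤ, (∃ k : ℤ,
          h + R₀ + 3 ≤ (L₂ (zigVertexS step₂ k + ((t 0 : ℝ) • triangularVec₁ 1 + (t 1 : ℝ) • triangularVec₂ 1)) + s₂) 2 ∧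
          (L₂ (zigVertexS step₂ k + ((t 0 : ℝ) • triangularVec₁ 1 + (t 1 : ℝ) • triangularVec₂ 1)) + s₂) 2 ≤ h + R₀ + 4 ∧
          Real.sqrt ((L₂ (zigVertexS step₂ k + ((t 0 : ℝ) • triangularVec₁ 1 + (t 1 : ℝ) • triangularVec₂ 1)) + s₂) 0 ^ 2 +
            (L₂ (zigVertexS step₂ k + ((t 0 : ℝ) • triangularVec₁ 1 + (t 1 : ℝ) • triangularVec₂ 1)) + s₂) 1 ^ 2) ≤ ρ - m) →
          t ∈ T₂) ∧
        (T₁.card : ℝ) + T₂.card + 36 * m * ρ ≤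
          (∑ y ∈ X.filter (fun y => (X.filter fun q => dist y q = 1).card ≠ 12 ∧ -R₀ - 2 ≤ y 2 ∧ y 2 ≤ h + R₀ + 2),
            ((12 : ℝ) - ((X.filter fun q => dist y q = 1).card : ℝ))) + (540 + 384 * R₀) * (1 + h) * ρ := by
  set e₃ : EuclideanSpace ℝ (Fin 3) := EuclideanSpace.single (2 : Fin 3) (1 : ℝ) with he₃
  have he₃n : ‖e₃‖ = 1 := by rw [he₃, PiLp.norm_single, norm_one]
  have hztn : ‖-e₃‖ = 1 := by rw [norm_neg, he₃n]
  -- the family slots, ∇ slots, machine steps, canonical states, selectors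
  set V₁ := best3 (fun w => ⟪w, L₁.symm e₃⟫_ℝ) upSlot₁ upSlot₂ upSlot₃ with hV₁
  set V₂ := best3 (fun w => ⟪w, L₂.symm (-e₃)⟫_ℝ) upSlot₁ upSlot₂ upSlot₃ with hV₂
  set G₁ := twinFrame L₁ (L₁ e₃) with hG₁
  set G₂ := twinFrame L₂ (L₂ e₃) with hG₂
  set q₁ := bestCapper G₁ (L₁ e₃) e₃ with hq₁
  set q₂ := bestCapper G₂ (L₂ e₃) (-e₃) with hq₂
  set ms₁ : ℤ → EuclideanSpace ℝ (Fin 3) := fun m => if σ₁ m = 1 then V₁ else basalMirror q₁ with hms₁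
  set ms₂ : ℤ → EuclideanSpace ℝ (Fin 3) := fun m => if σ₂ m = 1 then V₂ else basalMirror q₂ with hms₂
  set canon₁ : ℤ → EuclideanSpace ℝ (Fin 3) → EuclideanSpace ℝ (Fin 3) × List WalkEntry :=
    fun m t => if σ₁ (m - 1) = 1 then (t, [⟨L₁, V₁, 0⟩]) else (t, [⟨G₁, q₁, L₁ e₃⟩, ⟨L₁, V₁, 0⟩]) with hcanon₁
  set canon₂ : ℤ → EuclideanSpace ℝ (Fin 3) → EuclideanSpace ℝ (Fin 3) × List WalkEntry :=
    fun m t => if σ₂ (m - 1) = 1 then (t, [⟨L₂, V₂, 0⟩]) else (t, [⟨G₂, q₂, L₂ e₃⟩, ⟨L₂, V₂, 0⟩]) with hcanon₂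
  have hne : ¬ ((-1 : ℤ) = 1) := by decide
  have hms₁₁ : ∀ m, σ₁ m = 1 → ms₁ m = V₁ := fun m hm => by simp only [hms₁, hm, if_true]
  have hms₁₂ : ∀ m, σ₁ m = -1 → ms₁ m = basalMirror q₁ := fun m hm => by simp only [hms₁, hm, hne, if_false]
  have hms₂₁ : ∀ m, σ₂ m = 1 → ms₂ m = V₂ := fun m hm => by simp only [hms₂, hm, if_true]
  have hms₂₂ : ∀ m, σ₂ m = -1 → ms₂ m = basalMirror q₂ := fun m hm => by simp only [hms₂, hm, hne, if_false]
  have hcanon₁₁ : ∀ m t, σ₁ (m - 1) = 1 → canon₁ m t = (t, [⟨L₁, V₁, 0⟩]) := fun m t hm => by simp only [hcanon₁, hm, if_true]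
  have hcanon₁₂ : ∀ m t, σ₁ (m - 1) = -1 → canon₁ m t = (t, [⟨G₁, q₁, L₁ e₃⟩, ⟨L₁, V₁, 0⟩]) := fun m t hm => by
    simp only [hcanon₁, hm, hne, if_false]
  have hcanon₂₁ : ∀ m t, σ₂ (m - 1) = 1 → canon₂ m t = (t, [⟨L₂, V₂, 0⟩]) := fun m t hm => by simp only [hcanon₂, hm, if_true]
  have hcanon₂₂ : ∀ m t, σ₂ (m - 1) = -1 → canon₂ m t = (t, [⟨G₂, q₂, L₂ e₃⟩, ⟨L₂, V₂, 0⟩]) := fun m t hm => by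
    simp only [hcanon₂, hm, hne, if_false]
  set step₁ : ℤ → EuclideanSpace ℝ (Fin 3) := fun k => ms₁ (zigSlab L₁ e₃ k) with hstep₁
  set step₂ : ℤ → EuclideanSpace ℝ (Fin 3) := fun k => ms₂ (zigSlab L₂ (-e₃) k) with hstep₂
  have hsel₁ : IsZigSelector L₁ σ₁ e₃ step₁ := isZigSelector_machineStep σ₁ L₁ e₃ V₁ ms₁ hσ₁ hax₁ hV₁ hms₁₁ hms₁₂
  have hsel₂ : IsZigSelector L₂ σ₂ (-e₃) step₂ := isZigSelector_machineStep σ₂ L₂ (-e₃) V₂ ms₂ hσ₂ hax₂ hV₂ hms₂₁ hms₂₂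
  refine ⟨step₁, step₂, hsel₁, hsel₂, ?_⟩
  intro h hh ρ hρ X P₁ P₂ hX hP₁X hP₂X' hcyl hP₁ hP₂
  have hP₂X : P₂ ⊆ X := hP₂X'.trans Finset.sdiff_subset
  have hcell : ∀ p ∈ X, -(2 * R₀) ≤ p 2 ∧ p 2 ≤ h + 2 * R₀ ∧ p 0 ^ 2 + p 1 ^ 2 ≤ ρ ^ 2 := fun p hp => by
    have := hcyl p hp; simpa only [cyl, Set.mem_setOf_eq] using this
  -- slots, rises
  obtain ⟨hV₁s, hV₁2, -⟩ := familySlot_spec σ₁ L₁ e₃ V₁ hax₁ hV₁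
  obtain ⟨hV₂s, hV₂2, -⟩ := familySlot_spec σ₂ L₂ (-e₃) V₂ hax₂ hV₂
  have hδ₁ : ∀ m, (1 / 4 : ℝ) ≤ ⟪L₁ (ms₁ m), e₃⟫_ℝ := by
    intro m
    rw [inner_map_eq_inner_symm, (machineStep_spec σ₁ L₁ e₃ V₁ ms₁ hσ₁ hax₁ hV₁ hms₁₁ hms₁₂ m).1]
    exact quarter_le_bilayerRise L₁ σ₁ he₃n m
  have hδ₂ : ∀ m, (1 / 4 : ℝ) ≤ ⟪L₂ (ms₂ m), -e₃⟫_ℝ := by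
    intro m
    rw [inner_map_eq_inner_symm, (machineStep_spec σ₂ L₂ (-e₃) V₂ ms₂ hσ₂ hax₂ hV₂ hms₂₁ hms₂₂ m).1]
    exact quarter_le_bilayerRise L₂ σ₂ hztn m
  -- the polylines
  have hslab₁ : ∀ k, zigSlab L₁ e₃ k = k := fun k => by unfold zigSlab; rw [if_pos hax₁]
  have hslab₂ : ∀ k, zigSlab L₂ (-e₃) k = k := fun k => by unfold zigSlab; rw [if_pos hax₂]
  have hsucc₁ : ∀ k, zigVertexS step₁ (k + 1) = zigVertexS step₁ k + ms₁ k := fun k => by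
    rw [zigVertexS_succ]; simp only [hstep₁, hslab₁]
  have hsucc₂ : ∀ k, zigVertexS step₂ (k + 1) = zigVertexS step₂ k + ms₂ k := fun k => by
    rw [zigVertexS_succ]; simp only [hstep₂, hslab₂]
  have hlayer₁ : ∀ k, zigVertexS step₁ k ∈ barlowLayer 1 (Real.sqrt (2 / 3)) σ₁ k := fun k => by
    have := zigVertexS_mem_barlowLayer L₁ hσ₁ e₃ hsel₁ k
    unfold zigLayer at this; rwa [if_pos hax₁] at this
  have hlayer₂ : ∀ k, zigVertexS step₂ k ∈ barlowLayer 1 (Real.sqrt (2 / 3)) σ₂ k := fun k => by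
    have := zigVertexS_mem_barlowLayer L₂ hσ₂ (-e₃) hsel₂ k
    unfold zigLayer at this; rwa [if_pos hax₂] at this
  -- the line count with explicit margin
  have hq : (1 : ℝ) / 4 > 0 := by norm_num
  obtain ⟨T₁, T₂, hT₁, hT₂, hcount⟩ := barlow_lineCount_le_payers_explicit hX hsE hcert hDS hCP hσ₁ hσ₂ L₁ L₂ s₁ s₂ R₀ h ρ hR₀ hh
    (by linarith) P₁ P₂ hP₁X hP₂X hcell hP₁ hP₂ V₁ canon₁ ms₁ hV₁s hV₁2 hsteep₁ hcanon₁₁ hcanon₁₂ hms₁₁ hms₁₂ hq hδ₁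
    V₂ canon₂ ms₂ hV₂s hV₂2 hsteep₂ hcanon₂₁ hcanon₂₂ hms₂₁ hms₂₂ hq hδ₂ hoff₁ hoff₂ hdisjR
    (zigVertexS step₁) (zigVertexS step₂) hsucc₁ hlayer₁ hsucc₂ hlayer₂
  have hmin : min (1 / 4 : ℝ) (1 / 4) = 1 / 4 := min_self _
  rw [hmin] at hT₁ hT₂
  set m : ℝ := 3 + 8 / 3 * (h + 4 * R₀) + 3 / (1 / 4) with hm
  have hmval : m = 15 + 8 / 3 * h + 32 / 3 * R₀ := by rw [hm]; ring
  have hm0 : 0 ≤ m := by rw [hmval]; nlinarith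
  have hρ0 : 0 ≤ ρ := by linarith
  refine ⟨m, T₁, T₂, hm0, hT₁, hT₂, ?_⟩
  have hpen : 36 * m * ρ ≤ (540 + 384 * R₀) * (1 + h) * ρ := by
    rw [hmval]
    have h1 : 36 * (15 + 8 / 3 * h + 32 / 3 * R₀) ≤ (540 + 384 * R₀) * (1 + h) := by nlinarith
    exact mul_le_mul_of_nonneg_right h1 hρ0
  linarith

end Summit.Ventures.Crystal3D.Theorems

end
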